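import Mathlib
import HarnessLib
import HarnessLib.Audit
import Summits.ValiantsHypothesis.ValiantsHypothesis.Theorems.LacunarySymmetroidMatrixDescartesToyALawDefs

/-!
# ValiantsHypothesis / LacunarySymmetroid — crux `MatrixDescartes` (stmt-ValiantsHypothesis-18050, V1), LINE (A) «product_plus_one»:
# binomial-limit TOY THEOREM, module 1 — sign changes along chains and the Rolle step

Tools for pen val-idea-25 g8 NOTE §54.13 (kernel version of the TOY THEOREM, see `…ToyALawDefs`).  We count the sign
changes of a real function `φ` on a set `S` through CHAINS: `SignChangesLE φ S R` says that there is no chain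
`x 0 < x 1 < ⋯ < x (R+1)` of points of `S` along which `φ` strictly alternates in sign.  This is the classical number of
sign changes `V(φ) ≤ R` (Pólya–Szegő II, Part V, Chap. 1), in a form that needs no multiplicities (definition in `…ToyALawDefs`).  Proved here:
monotonicity, invariance under positive factors, the ROLLE STEP `V(h) ≤ V(h') + 1` on an order-connected set (mean value
theorem between consecutive chain points), one-signedness from `V = 0`, and the polynomial base case
`V(w · P) ≤ natDegree P` for a positive weight `w` (intermediate value theorem + `card roots ≤ natDegree`).

HONEST FRAMING: generic real-analysis helpers; no stub of LINE (A) is touched; `MatrixDescartes` OPEN; `VP ≠ VNP` is NOT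
proved and nothing here bears on it.
-/

set_option linter.dupNamespace false

namespace Summit.ValiantsHypothesis.ValiantsHypothesis.Theorems.LacunarySymmetroidMatrixDescartes

namespace ToyALaw

open Polynomial Set

variable {φ ψ w : ℝ → ℝ} {S S' : Set ℝ} {R R' : ℕ}

/-- Monotonicity in the bound. -/
theorem SignChangesLE.mono (h : SignChangesLE φ S R) (hR : R ≤ R') : SignChangesLE φ S R' := by
  intro x hxS hx
  obtain ⟨i, hi, h0⟩ := h x (fun i hi => hxS i (by omega)) (fun i hi => hx i (by omega))
  exact ⟨i, hi.trans hR, h0⟩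

/-- Monotonicity in the set. -/
theorem SignChangesLE.anti (h : SignChangesLE φ S R) (hS : S' ⊆ S) : SignChangesLE φ S' R :=
  fun x hxS hx => h x (fun i hi => hS (hxS i hi)) hx

/-- Pointwise-equal functions on `S` have the same sign-change bound. -/
theorem SignChangesLE.congr (h : SignChangesLE φ S R) (he : ∀ x ∈ S, φ x = ψ x) : SignChangesLE ψ S R := by
  intro x hxS hx
  obtain ⟨i, hi, h0⟩ := h x hxS hx
  refine ⟨i, hi, ?_⟩
  rwa [← he _ (hxS i (by omega)), ← he _ (hxS (i + 1) (by omega))]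

/-- Multiplying by a weight that is positive on `S` does not change the sign-change bound. -/
theorem SignChangesLE.mul_pos (h : SignChangesLE φ S R) (hw : ∀ x ∈ S, 0 < w x) :
    SignChangesLE (fun x => w x * φ x) S R := by
  intro x hxS hx
  obtain ⟨i, hi, h0⟩ := h x hxS hx
  refine ⟨i, hi, ?_⟩
  have h1 := hw _ (hxS i (by omega))
  have h2 := hw _ (hxS (i + 1) (by omega))
  have : w (x i) * φ (x i) * (w (x (i + 1)) * φ (x (i + 1))) =
      (w (x i) * w (x (i + 1))) * (φ (x i) * φ (x (i + 1))) := by ring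
  rw [this]
  exact mul_nonneg (_root_.mul_pos h1 h2).le h0

/-- Dividing out a weight that is positive on `S` does not change the sign-change bound. -/
theorem SignChangesLE.of_mul_pos (h : SignChangesLE (fun x => w x * φ x) S R) (hw : ∀ x ∈ S, 0 < w x) :
    SignChangesLE φ S R := by
  have h' := h.mul_pos (w := fun x => (w x)⁻¹) (fun x hx => inv_pos.2 (hw x hx))
  refine h'.congr fun x hx => ?_
  have := (hw x hx).ne'
  field_simp

/-- The zero function has no sign changes. -/
theorem signChangesLE_zero : SignChangesLE (fun _ => (0 : ℝ)) S R :=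
  fun _ _ _ => ⟨0, Nat.zero_le _, by simp⟩

/-- A function that is `≥ 0` on `S` has no sign change on `S`. -/
theorem signChangesLE_of_nonneg (h : ∀ x ∈ S, 0 ≤ φ x) : SignChangesLE φ S 0 :=
  fun x hxS _ => ⟨0, le_rfl, mul_nonneg (h _ (hxS 0 (by omega))) (h _ (hxS 1 (by omega)))⟩

/-- A function that is `≤ 0` on `S` has no sign change on `S`. -/
theorem signChangesLE_of_nonpos (h : ∀ x ∈ S, φ x ≤ 0) : SignChangesLE φ S 0 :=
  fun x hxS _ => ⟨0, le_rfl, mul_nonneg_of_nonpos_of_nonpos (h _ (hxS 0 (by omega))) (h _ (hxS 1 (by omega)))⟩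

/-- Conversely, `V_S(φ) = 0` means `φ` is weakly one-signed on `S`: `φ a · φ b ≥ 0` for all `a, b ∈ S`. -/
theorem SignChangesLE.mul_nonneg_of_zero (h : SignChangesLE φ S 0) {a b : ℝ} (ha : a ∈ S) (hb : b ∈ S) :
    0 ≤ φ a * φ b := by
  rcases lt_trichotomy a b with hab | rfl | hab
  · obtain ⟨i, hi, h0⟩ := h (fun i => if i = 0 then a else b)
      (fun i _ => by split_ifs <;> assumption) (fun i hi => by
        have : i = 0 := by omega
        subst this; simpa using hab)
    have : i = 0 := by omega
    subst this; simpa using h0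
  · exact mul_self_nonneg _
  · obtain ⟨i, hi, h0⟩ := h (fun i => if i = 0 then b else a)
      (fun i _ => by split_ifs <;> assumption) (fun i hi => by
        have : i = 0 := by omega
        subst this; simpa using hab)
    have : i = 0 := by omega
    subst this
    simp at h0
    linarith [mul_comm (φ a) (φ b)]

/-- Sign bookkeeping along an alternating triple: if `a·b < 0` and `b·c < 0` then `(b − a)·(c − b) < 0`. -/
theorem mul_sub_sub_neg_of_alt {a b c : ℝ} (hab : a * b < 0) (hbc : b * c < 0) : (b - a) * (c - b) < 0 := by
  have hb : b ≠ 0 := by rintro rfl; simp at hab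
  have hb2 : 0 < b ^ 2 := by positivity
  have hac : 0 < a * c := by nlinarith [mul_pos_of_neg_of_neg hab hbc]
  nlinarith

/-- **Rolle step for sign changes** (`V(h) ≤ V(h') + 1`): if `h` has derivative `h'` at every point of an order-connected
set `S` and `h'` has at most `R` sign changes on `S`, then `h` has at most `R + 1` sign changes on `S`.  Proof: between two
consecutive points of an alternating chain for `h` the mean value theorem produces a point where `h'` has the sign of the
increment; these points form an alternating chain for `h'` that is one shorter.  No multiplicities are involved. -/
theorem SignChangesLE.of_hasDerivAt {h h' : ℝ → ℝ} (hS : S.OrdConnected)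
    (hd : ∀ x ∈ S, HasDerivAt h (h' x) x) (H : SignChangesLE h' S R) :
    SignChangesLE h S (R + 1) := by
  intro x hxS hx
  by_contra hcon
  push Not at hcon
  have key : ∀ i ≤ R + 1, ∃ y ∈ Ioo (x i) (x (i + 1)),
      h' y * (x (i + 1) - x i) = h (x (i + 1)) - h (x i) := by
    intro i hi
    have hab : x i < x (i + 1) := hx i hi
    have hsub : Icc (x i) (x (i + 1)) ⊆ S := hS.out (hxS i (by omega)) (hxS (i + 1) (by omega))
    obtain ⟨y, hy, hy'⟩ := exists_hasDerivAt_eq_slope h h' hab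
      (fun z hz => (hd z (hsub hz)).continuousAt.continuousWithinAt)
      (fun z hz => hd z (hsub (Ioo_subset_Icc_self hz)))
    refine ⟨y, hy, ?_⟩
    rw [hy']
    exact div_mul_cancel₀ _ (sub_pos.2 hab).ne'
  choose! y hy hy' using key
  have hyS : ∀ i ≤ R + 1, y i ∈ S := fun i hi =>
    (hS.out (hxS i (by omega)) (hxS (i + 1) (by omega))) (Ioo_subset_Icc_self (hy i hi))
  have hymono : ∀ i ≤ R, y i < y (i + 1) := fun i hi =>
    ((hy i (by omega)).2).trans (hy (i + 1) (by omega)).1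
  obtain ⟨i, hi, hprod⟩ := H y hyS hymono
  · have h1 := hcon i (by omega)
    have h2 := hcon (i + 1) (by omega)
    have e1 := hy' i (by omega)
    have e2 := hy' (i + 1) (by omega)
    have d1 : 0 < x (i + 1) - x i := sub_pos.2 (hx i (by omega))
    have d2 : 0 < x (i + 1 + 1) - x (i + 1) := sub_pos.2 (hx (i + 1) (by omega))
    have hneg := mul_sub_sub_neg_of_alt h1 h2
    rw [← e1, ← e2] at hneg
    have : h' (y i) * (x (i + 1) - x i) * (h' (y (i + 1)) * (x (i + 1 + 1) - x (i + 1))) =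
        (h' (y i) * h' (y (i + 1))) * ((x (i + 1) - x i) * (x (i + 1 + 1) - x (i + 1))) := by ring
    rw [this] at hneg
    have hpos : 0 < (x (i + 1) - x i) * (x (i + 1 + 1) - x (i + 1)) := _root_.mul_pos d1 d2
    nlinarith

/-- Iterated Rolle step: if the `m`-th function in a chain of derivatives has at most `R` sign changes, the `0`-th has at
most `R + m`.  Here `g j` is the `j`-th derivative: `HasDerivAt (g j) (g (j+1) x) x` on `S`. -/
theorem SignChangesLE.of_hasDerivAt_iterate {g : ℕ → ℝ → ℝ} (hS : S.OrdConnected)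
    (hd : ∀ j, ∀ x ∈ S, HasDerivAt (g j) (g (j + 1) x) x) {m : ℕ} (H : SignChangesLE (g m) S R) :
    SignChangesLE (g 0) S (R + m) := by
  induction m generalizing R with
  | zero => simpa using H
  | succ m ih =>
    have h1 : SignChangesLE (g m) S (R + 1) := SignChangesLE.of_hasDerivAt hS (hd m) H
    have := ih h1
    simpa [Nat.add_assoc, Nat.add_comm 1 m] using this

/-- Intermediate value theorem in product form: a continuous function with `f a · f b < 0` vanishes inside `(a, b)`. -/
theorem exists_zero_of_mul_neg {f : ℝ → ℝ} {a b : ℝ} (hab : a < b) (hf : ContinuousOn f (Icc a b))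
    (h : f a * f b < 0) : ∃ z ∈ Ioo a b, f z = 0 := by
  rcases mul_neg_iff.1 h with ⟨ha, hb⟩ | ⟨ha, hb⟩
  · obtain ⟨z, hz, hz0⟩ := intermediate_value_Ioo' hab.le hf ⟨hb, ha⟩
    exact ⟨z, hz, hz0⟩
  · obtain ⟨z, hz, hz0⟩ := intermediate_value_Ioo hab.le hf ⟨ha, hb⟩
    exact ⟨z, hz, hz0⟩

/-- **Polynomial base case** (`V(w·P) ≤ deg P`): for a nonzero real polynomial `P` and a weight `w > 0` on `S`, the function
`w · P` has at most `natDegree P` sign changes on `S` (each strict alternation encloses a root; `card roots ≤ natDegree`). -/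
theorem signChangesLE_mul_polynomial (hw : ∀ x ∈ S, 0 < w x) {P : ℝ[X]} (hP : P ≠ 0) :
    SignChangesLE (fun x => w x * P.eval x) S P.natDegree := by
  refine SignChangesLE.mul_pos ?_ hw
  intro x hxS hx
  by_contra hcon
  push Not at hcon
  have key : ∀ i ≤ P.natDegree, ∃ z ∈ Ioo (x i) (x (i + 1)), P.eval z = 0 := fun i hi =>
    exists_zero_of_mul_neg (hx i hi) (P.continuousOn_aeval) (hcon i hi)
  choose! z hz hz0 using key
  have hzmono : StrictMonoOn z (Finset.range (P.natDegree + 1) : Set ℕ) := by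
    intro i hi j hj hij
    simp only [Finset.coe_range, mem_Iio] at hi hj
    have step : ∀ k, k + 1 ≤ P.natDegree → z k < z (k + 1) := fun k hk =>
      ((hz k (by omega)).2).trans (hz (k + 1) hk).1
    -- chain the steps from i to j
    have : ∀ d, i + d + 1 ≤ P.natDegree + 0 → i + d < P.natDegree + 1 → z i < z (i + d + 1) := by
      intro d
      induction d with
      | zero => intro h1 _; simpa using step i (by omega)
      | succ d ihd =>
        intro h1 h2
        have := ihd (by omega) (by omega)
        have h3 := step (i + d + 1) (by omega)
        calc z i < z (i + d + 1) := this
          _ < z (i + d + 1 + 1) := h3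
          _ = z (i + (d + 1) + 1) := by ring_nf
    obtain ⟨d, rfl⟩ : ∃ d, j = i + d + 1 := ⟨j - i - 1, by omega⟩
    exact this d (by omega) (by omega)
  have hcard : (Finset.image z (Finset.range (P.natDegree + 1))).card = P.natDegree + 1 := by
    rw [Finset.card_image_of_injOn hzmono.injOn, Finset.card_range]
  have hsub : Finset.image z (Finset.range (P.natDegree + 1)) ⊆ P.roots.toFinset := by
    intro y hy
    simp only [Finset.mem_image, Finset.mem_range] at hy
    obtain ⟨i, hi, rfl⟩ := hy
    rw [Multiset.mem_toFinset, mem_roots hP]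
    exact hz0 i (by omega)
  have h1 := Finset.card_le_card hsub
  have h2 : P.roots.toFinset.card ≤ P.natDegree :=
    (Multiset.toFinset_card_le _).trans (card_roots' P)
  omega

end ToyALaw

end Summit.ValiantsHypothesis.ValiantsHypothesis.Theorems.LacunarySymmetroidMatrixDescartes
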